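import Mathlib
import HarnessLib

/-!
# Route `PrimeLevelFamEdge`, crux K_B (stmt-Parity-20343), line `diagonal_kernel_split`, helper H4
# (exact Petersson/AFE split), part (d3): the divisor fibre count behind the diagonal resummation

Pure arithmetic of divisors (no analysis): for `a, b ≥ 1`,
* `card_coprime_divisorPairs` — coprime pairs `(u, v)`, `u ∣ A`, `v ∣ B`, are in bijection with the
  divisors of `AB` (`(u,v) ↦ u·(B/v)`, inverse `e ↦ (e/(e,B), B/(e,B))`): their number is `τ(AB)`;
* `card_divisorPairs_gcd_eq` — for `c ∣ (a,b)`: `#{(u,v) : u ∣ a, v ∣ b, (u,v) = c} = τ((a/c)(b/c))`;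
* **`sum_divisorPairs_gcd`** — `Σ_{d₁∣a, d₂∣b} G((a/d₁, b/d₂)) = Σ_{c ∣ (a,b)} τ((a/c)(b/c))·G(c)`.
This is the counting step that identifies the Petersson `δ`-terms of the AFE ⊗ Hecke expansion with the
TRUE diagonal kernel `Corner.trueDiagKernel` (`Σ_{c∣(a,b)} c·τ(ab/c²)·𝒲(ab/(c²Q²))/(ab)`) of helper H1
([KowalskiMichelVanderKam2000] (21)–(23) p. 12–13; STUB-PLAN §7). Helper; closes nothing; theorems only.
«The programme SEARCHES and TYPES; no claim about Landau–Siegel zeros, Theorems 1–2 of arXiv:2211.02515 or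
a repaired Margin232 until a kernel theorem says so.»
-/

open Finset

namespace Summit.Parity.GeneralizedHardyLittlewood.Theorems.BeyondDiagonalBeatsQuarter.PeterssonSplit

/-- **Coprime divisor pairs of `(A, B)` ↔ divisors of `AB`.** For `A, B ≠ 0`:
`#{(u,v) : u ∣ A, v ∣ B, (u,v) = 1} = τ(AB)` via `(u,v) ↦ u·(B/v)`. [folklore] -/
theorem card_coprime_divisorPairs {A B : ℕ} (hA : A ≠ 0) (hB : B ≠ 0) :
    ((A.divisors ×ˢ B.divisors).filter (fun p : ℕ × ℕ ↦ p.1.Coprime p.2)).card =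
      (A * B).divisors.card := by
  refine Finset.card_nbij' (fun p : ℕ × ℕ ↦ p.1 * (B / p.2)) (fun e ↦ (e / e.gcd B, B / e.gcd B))
    ?_ ?_ ?_ ?_
  · -- maps to
    intro p hp
    simp only [Finset.coe_filter, Finset.mem_product, Nat.mem_divisors, Set.mem_setOf_eq] at hp
    simp only [Finset.mem_coe, Nat.mem_divisors]
    exact ⟨Nat.mul_dvd_mul hp.1.1.1 (Nat.div_dvd_of_dvd hp.1.2.1), mul_ne_zero hA hB⟩
  · -- inverse maps to
    intro e he
    simp only [Finset.mem_coe, Nat.mem_divisors] at he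
    obtain ⟨heAB, -⟩ := he
    have he0 : e ≠ 0 := fun h ↦ by rw [h] at heAB; exact mul_ne_zero hA hB (Nat.eq_zero_of_zero_dvd heAB)
    set g := e.gcd B with hg
    have hg0 : 0 < g := Nat.gcd_pos_of_pos_left _ (Nat.pos_of_ne_zero he0)
    have hgB : g ∣ B := Nat.gcd_dvd_right _ _
    have hge : g ∣ e := Nat.gcd_dvd_left _ _
    have hcop : (e / g).Coprime (B / g) := Nat.coprime_div_gcd_div_gcd hg0
    have h1 : e / g ∣ A * (B / g) := by
      have : e ∣ A * (B / g) * g := by rwa [mul_assoc, Nat.div_mul_cancel hgB]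
      exact Nat.dvd_of_mul_dvd_mul_right hg0 (by rwa [Nat.div_mul_cancel hge])
    simp only [Finset.coe_filter, Finset.mem_product, Nat.mem_divisors, Set.mem_setOf_eq]
    exact ⟨⟨⟨hcop.dvd_of_dvd_mul_right h1, hA⟩, Nat.div_dvd_of_dvd hgB, hB⟩, hcop⟩
  · -- left inverse
    intro p hp
    simp only [Finset.coe_filter, Finset.mem_product, Nat.mem_divisors, Set.mem_setOf_eq] at hp
    obtain ⟨⟨⟨-, -⟩, h2, -⟩, hcop⟩ := hp
    set k := B / p.2 with hk_def
    have hk : k ≠ 0 := by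
      intro h0; exact hB (Nat.eq_zero_of_dvd_of_div_eq_zero h2 h0)
    have hB' : B = p.2 * k := (Nat.mul_div_cancel' h2).symm
    have hgcd : (p.1 * k).gcd B = k := by
      rw [hB', Nat.gcd_mul_right, hcop, one_mul]
    show ((p.1 * k) / (p.1 * k).gcd B, B / (p.1 * k).gcd B) = p
    rw [hgcd]
    ext
    · exact Nat.mul_div_cancel _ (Nat.pos_of_ne_zero hk)
    · exact Nat.div_div_self h2 hB
  · -- right inverse
    intro e he
    simp only [Finset.mem_coe, Nat.mem_divisors] at he
    simp only
    rw [Nat.div_div_self (Nat.gcd_dvd_right _ _) hB, Nat.div_mul_cancel (Nat.gcd_dvd_left _ _)]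

/-- **The `gcd`-fibres of divisor pairs.** For `a, b ≠ 0` and `c ∣ gcd(a,b)`:
`#{(u,v) : u ∣ a, v ∣ b, gcd(u,v) = c} = τ((a/c)·(b/c))` (scale by `c`, then `card_coprime_divisorPairs`).
[folklore] -/
theorem card_divisorPairs_gcd_eq {a b c : ℕ} (ha : a ≠ 0) (hb : b ≠ 0) (hc : c ∣ a.gcd b) :
    ((a.divisors ×ˢ b.divisors).filter (fun p : ℕ × ℕ ↦ p.1.gcd p.2 = c)).card =
      ((a / c) * (b / c)).divisors.card := by
  have hca : c ∣ a := hc.trans (Nat.gcd_dvd_left _ _)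
  have hcb : c ∣ b := hc.trans (Nat.gcd_dvd_right _ _)
  have hc0 : c ≠ 0 := fun h ↦ ha (Nat.eq_zero_of_zero_dvd (h ▸ hca))
  have hc0' : 0 < c := Nat.pos_of_ne_zero hc0
  have hA : a / c ≠ 0 := fun h ↦ ha (Nat.eq_zero_of_dvd_of_div_eq_zero hca h)
  have hB : b / c ≠ 0 := fun h ↦ hb (Nat.eq_zero_of_dvd_of_div_eq_zero hcb h)
  rw [← card_coprime_divisorPairs hA hB]
  refine Finset.card_nbij' (fun p : ℕ × ℕ ↦ (p.1 / c, p.2 / c)) (fun p ↦ (c * p.1, c * p.2)) ?_ ?_ ?_ ?_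
  · intro p hp
    simp only [Finset.coe_filter, Finset.mem_product, Nat.mem_divisors, Set.mem_setOf_eq] at hp ⊢
    obtain ⟨⟨⟨h1, -⟩, h2, -⟩, hg⟩ := hp
    have hc1 : c ∣ p.1 := hg ▸ Nat.gcd_dvd_left _ _
    have hc2 : c ∣ p.2 := hg ▸ Nat.gcd_dvd_right _ _
    refine ⟨⟨⟨Nat.div_dvd_div hc1 h1, hA⟩, Nat.div_dvd_div hc2 h2, hB⟩, ?_⟩
    have hpos : 0 < p.1.gcd p.2 := by rw [hg]; exact hc0'
    have := Nat.coprime_div_gcd_div_gcd hpos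
    rwa [hg] at this
  · intro p hp
    simp only [Finset.coe_filter, Finset.mem_product, Nat.mem_divisors, Set.mem_setOf_eq] at hp ⊢
    obtain ⟨⟨⟨h1, -⟩, h2, -⟩, hg⟩ := hp
    refine ⟨⟨⟨?_, ha⟩, ?_, hb⟩, ?_⟩
    · calc c * p.1 ∣ c * (a / c) := Nat.mul_dvd_mul_left c h1
        _ = a := Nat.mul_div_cancel' hca
    · calc c * p.2 ∣ c * (b / c) := Nat.mul_dvd_mul_left c h2
        _ = b := Nat.mul_div_cancel' hcb
    · rw [Nat.gcd_mul_left, hg, mul_one]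
  · intro p hp
    simp only [Finset.coe_filter, Finset.mem_product, Nat.mem_divisors, Set.mem_setOf_eq] at hp
    obtain ⟨-, hg⟩ := hp
    have hc1 : c ∣ p.1 := hg ▸ Nat.gcd_dvd_left _ _
    have hc2 : c ∣ p.2 := hg ▸ Nat.gcd_dvd_right _ _
    ext <;> simp [Nat.mul_div_cancel' hc1, Nat.mul_div_cancel' hc2]
  · intro p _
    ext <;> simp [Nat.mul_div_cancel_left _ hc0']

/-- **The fibre sum.** For `a, b ≠ 0` and any `G`:
`Σ_{d₁ ∣ a, d₂ ∣ b} G(gcd(a/d₁, b/d₂)) = Σ_{c ∣ gcd(a,b)} τ((a/c)(b/c))·G(c)`.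
[cite: KowalskiMichelVanderKam2000, (21)–(23) p. 12 — derivation (the divisor bookkeeping of the diagonal)] -/
theorem sum_divisorPairs_gcd {a b : ℕ} (ha : a ≠ 0) (hb : b ≠ 0) (G : ℕ → ℝ) :
    ∑ p ∈ a.divisors ×ˢ b.divisors, G ((a / p.1).gcd (b / p.2)) =
      ∑ c ∈ (a.gcd b).divisors, ((((a / c) * (b / c)).divisors.card : ℕ) : ℝ) * G c := by
  -- reflect both coordinates: (d₁, d₂) ↦ (a/d₁, b/d₂)
  have h1 : ∑ p ∈ a.divisors ×ˢ b.divisors, G ((a / p.1).gcd (b / p.2)) =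
      ∑ p ∈ a.divisors ×ˢ b.divisors, G (p.1.gcd p.2) := by
    rw [Finset.sum_product, Finset.sum_product]
    show ∑ u ∈ a.divisors, ∑ v ∈ b.divisors, G ((a / u).gcd (b / v)) =
      ∑ u ∈ a.divisors, ∑ v ∈ b.divisors, G (u.gcd v)
    calc ∑ u ∈ a.divisors, ∑ v ∈ b.divisors, G ((a / u).gcd (b / v))
        = ∑ u ∈ a.divisors, ∑ v ∈ b.divisors, G ((a / u).gcd v) :=
          Finset.sum_congr rfl fun u _ ↦ Nat.sum_div_divisors b (fun v ↦ G ((a / u).gcd v))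
      _ = ∑ u ∈ a.divisors, ∑ v ∈ b.divisors, G (u.gcd v) :=
          Nat.sum_div_divisors a (fun u ↦ ∑ v ∈ b.divisors, G (u.gcd v))
  rw [h1]
  -- group by the value of gcd
  have hmaps : ∀ p ∈ a.divisors ×ˢ b.divisors, p.1.gcd p.2 ∈ (a.gcd b).divisors := by
    intro p hp
    simp only [Finset.mem_product, Nat.mem_divisors] at hp
    rw [Nat.mem_divisors]
    exact ⟨Nat.dvd_gcd ((Nat.gcd_dvd_left _ _).trans hp.1.1) ((Nat.gcd_dvd_right _ _).trans hp.2.1),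
      Nat.gcd_ne_zero_left ha⟩
  rw [← Finset.sum_fiberwise_of_maps_to' hmaps]
  refine Finset.sum_congr rfl fun c hc ↦ ?_
  rw [Finset.sum_const, nsmul_eq_mul, card_divisorPairs_gcd_eq ha hb (Nat.dvd_of_mem_divisors hc)]

end Summit.Parity.GeneralizedHardyLittlewood.Theorems.BeyondDiagonalBeatsQuarter.PeterssonSplit
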